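import Literature.Topology.FourManifolds.SurfaceGroupNielsenCoreCaseJPAux
import Literature.Topology.FourManifolds.SurfaceGroupNielsenCoreCasePPSame
import Literature.Topology.FourManifolds.SurfaceGroupNielsenCoreNoDoublePoint
import HarnessLib

/-!
# Nielsen's theorem, pillar CORE: a double point at a junction followed by a portal

Topic `Literature/Topology/FourManifolds`.  The case J-P of the case analysis of a double point
`a < b` on the closed path `C` of a potential-minimal configuration (Zieschang–Vogt–Coldewey,
LNM 835, proof of Thm. 5.3.2 with Lemma 5.3.4, in the lead's minimal-counterexample recasting):
the cut `a` is the JUNCTION in front of the kernel of the occurrence `k₂` (`Kstart k₂ = a`; spur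
`head k₂` of length `c_a = jc (k₂ - 1)`), and the cut `b` is a PORTAL, interior to the kernel of
the occurrence `k'`, between the slots `sb - 1 | sb` of its value `V'` (`n' = |V'|`); the partner
`k̄'` of `k'` is not a portal, hence inside or outside.

In both cases the crossing edges of the fixation are the cancelling edges of the `a`-spur (one
at each level `e < c_a`) and the formal edges of the symbol of `k'` at the far side of the cut
(`SurfaceGroupNielsenCoreCaseJPAux.lean`); the parity principle of
`BinaryProductParity.lean` (no lone crossing edge at a level; two crossing edges alone at
their level share a component, on which letters are governed by the types) then identifies the
spur word `head k₂` with a segment of `V'` or of its inverse, which turns the double point into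
an identity of start vertices of occurrences and exhibits a non-empty proper symbol-closed block
of consecutive letters with trivial value — contradicting indecomposability
(`false_of_occStart_eq`):

* `false_of_doublePoint_JP_inside` (`k̄'` inside): `c_a = n' - sb`,
  `head k₂ = (V'[sb, n'))⁻¹`, `E_{k₂} = E_{k'+1}`, block `k₂, …, k'`;
* `false_of_doublePoint_JP_outside` (`k̄'` outside): `c_a = sb`, `head k₂ = V'[0, sb)`,
  `E_{k₂} = E_{k'}`, block `k₂, …, k' - 1`.

## References

* H. Zieschang, E. Vogt, H.-D. Coldewey, *Surfaces and Planar Discontinuous Groups*, LNM 835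
  (1980), proof of Thm. 5.3.2 and Lemma 5.3.4. [ZieschangVogtColdewey1980]
-/

noncomputable section

namespace Literature.Topology.FourManifolds

open Literature.GroupTheory.CombinatorialGroupTheory CycFactors List

namespace SurfaceGroup

namespace Config

variable {g : ℕ} {φ : surfaceGen g → SurfaceGroup g}

section JP

variable (hg : 2 ≤ g) (hK : RelatorKilled φ) (hI : Indecomposable φ) (hM : MarkedNontrivial φ)
  (κ : Config φ) (hmin : κ.IsMin) (d : κ.DoublePoint)
include hg hK hI hM hmin

omit hK in
/-- **No double point at a junction followed by a portal whose partner is inside.**  With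
`a = Kstart k₂` (spur `c_a = jc (k₂ - 1)`), `b` between the slots `sb - 1 | sb` of the value `V'`
of `k'` (`n' = |V'|`) and `k̄'` inside: the crossing edges are the cancelling edges of the
`a`-spur (levels `e < c_a`) and the formal edges at the post-cut slots `(k', q)`, `q ≥ sb`, whose
partners `(k̄', n' - 1 - q)` are head slots (levels `< n' - sb`); the parity principle gives
`c_a = n' - sb` and pairs the two edges of each level in one component, so the head slots
`(k₂, e)` and `(k̄', e)` carry the same letter: `head k₂ = invRev (V'[sb, n'))`.  Hence
`E_{k₂} = absv a · (head k₂)⁻¹ = E_{k'} · V'[0, sb) · V'[sb, n') = E_{k'+1}`, and the block of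
occurrences `k₂, …, k'` (symbol-closed by Claim (A), proper since otherwise `k' = k₂ - 1`
cyclically and the post-cut kernel of `k'` would be empty) has trivial value — a decomposition.
[cite: ZieschangVogtColdewey1980, proof of Thm. 5.3.2 and Lemma 5.3.4] -/
theorem false_of_doublePoint_JP_inside {k' : ℕ} (hJa : κ.IsJunction d.a) (hPb : κ.PortalAt d.b k')
    (hin : κ.Inside d.a d.b (κ.bar k')) : False := by
  have hg1 : 1 ≤ g := by omega
  have hN := κ.cycNielsen_U hg1 hI hM hmin
  have hU := κ.U_ne_nil hg1
  have hbar := κ.isPairing_bar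
  have hab := d.lt
  have hbℓ := d.lt_length
  obtain ⟨k₂, hk₂, hKa⟩ := hJa
  have hsep : ∀ j, ¬ (κ.PortalAt d.a j ∧ κ.PortalAt d.b j) := fun j hj =>
    κ.not_portalAt_of_isJunction ⟨k₂, hk₂, hKa⟩ j hj.1
  have hP2 := DoublePoint.kpos_mem_iff_of_chainEnd κ hg1 hI hM hmin d
  have hk' : k' < κ.w.length := κ.lt_length_of_portalAt hPb hbℓ.le
  have hk'U : k' < κ.U.length := by rw [length_U]; exact hk'
  have hk₂U : k₂ < κ.U.length := by rw [length_U]; exact hk₂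
  have hbb : κ.bar (κ.bar k') = k' := hbar.bar_bar k' hk'U
  have hk₂k' : k₂ ≤ k' := (κ.Kstart_le_Kstart_iff hg1 hI hM hmin).1
    (by rw [hKa]; exact κ.le_Kstart_of_portalAt_right hab hsep hPb)
  obtain ⟨hc₁sb, hsbn⟩ := κ.slotAt_bounds_of_portalAt hg1 hI hM hmin hPb
  have hcale : jc κ.U (cpred κ.U k₂) ≤ (fac κ.U k₂).length := jc_cpred_le_length κ.U k₂
  -- numerical data
  set n' := (fac κ.U k').length with hn'
  have hnbar : (fac κ.U (κ.bar k')).length = n' := hbar.length_fac_bar hk'U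
  have hVbar : fac κ.U (κ.bar k') = FreeGroup.invRev (fac κ.U k') := hbar.fac_bar k' hk'U
  set c₂ := jc κ.U k' with hc₂
  set ca := jc κ.U (cpred κ.U k₂) with hca
  set sb := κ.slotAt k' d.b with hsb
  -- the side function and (P2)
  let s : ℕ × ℕ → Bool := fun σ => decide (κ.SideIn d.a d.b σ)
  have hs : ∀ σ, s σ = decide (κ.SideIn d.a d.b σ) := fun σ => rfl
  have hP2s : ∀ τ, IsKernelSlot κ.U τ → s τ = s (chainEnd κ.U κ.bar τ) := fun τ hτ =>
    κ.decide_sideIn_eq_decide_sideIn_chainEnd hg1 hI hM hmin hab hsep hP2 hτ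
  -- the crossing `c`-edges: at the head slots `(k₂, e)`, `e < ca`, of level `e`
  have hh₂ : ∀ e, e < ca → IsHeadSlot κ.U (k₂, e) := fun e he =>
    ⟨⟨hk₂U, lt_of_lt_of_le he hcale⟩, he⟩
  have hLc : ∀ e, e < ca → ∀ ρ ∈ (cedge κ.U (k₂, e)).2, level κ.U ρ = e := fun e he =>
    jp_level_cedge hN hU hbar (hh₂ e he)
  have hXc : ∀ e, e < ca → IsCrossing s (cedge κ.U (k₂, e)) := fun e he =>
    κ.jp_isCrossing_cedge hg1 hI hM hmin d hk₂ hKa hs he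
  have hall : ∀ {ε : CycFactors.Edge}, IsEdge κ.U κ.bar ε → IsCrossing s ε →
      (∃ e, e < ca ∧ ε = cedge κ.U (k₂, e)) ∨ (∃ q, q < n' ∧ ε = fedge κ.U κ.bar (k', q)) :=
    fun hε hc => κ.jp_crossing_edges hg1 hI hM hmin d hk₂ hKa hPb hs hε hc
  -- the crossing `f`-edges: at the post-cut slots `(k', q)`, `sb ≤ q`, facing head slots
  have hX : ∀ q, IsCrossing s (fedge κ.U κ.bar (k', q)) ↔ sb ≤ q := fun q => by
    rw [isCrossing_fedge, hs, hs, ← κ.fcross_iff_decide_ne]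
    exact κ.fcross_iff_of_portalAt_right_of_inside hsep hPb hin q
  have hhd : ∀ q, sb ≤ q → q < n' → IsHeadSlot κ.U (κ.bar k', n' - 1 - q) := fun q hq1 hq2 =>
    κ.isHeadSlot_of_portalAt_right_of_inside hg1 hI hM hmin hP2 hk' hPb hin hq1 hq2
  have hLf : ∀ q, sb ≤ q → q < n' →
      ∀ ρ ∈ (fedge κ.U κ.bar (k', q)).2, level κ.U ρ = n' - 1 - q := fun q hq1 hq2 =>
    jp_level_fedge_head hN hU hbar ⟨hk'U, hq2⟩ (hhd q hq1 hq2)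
  -- PARITY, I: `ca ≤ n' - sb` (else the `c`-edge of level `n' - sb` would be alone)
  have h1 : ca ≤ n' - sb := by
    by_contra hlt
    have he : n' - sb < ca := by omega
    have hh := hh₂ _ he
    refine false_of_crossing_alone_level hN hU hbar hP2s
      (isEdge_cedge hh.1 fun hk => hk.not_isHeadSlot hh) (hXc _ he)
      ⟨(k₂, n' - sb), mem_cedge.2 (Or.inl rfl), hLc _ he _ (mem_cedge.2 (Or.inl rfl))⟩
      fun ε' hε' hc' hlev => ?_
    rcases hall hε' hc' with ⟨e', he', rfl⟩ | ⟨q', hq', rfl⟩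
    · have e1 := (hLc e' he' _ (mem_cedge.2 (Or.inl rfl))).symm.trans
        (hlev (k₂, e') (mem_cedge.2 (Or.inl rfl)))
      rw [e1]
    · have hq'1 : sb ≤ q' := (hX q').1 hc'
      have e1 := (hLf q' hq'1 hq' _ (mem_fedge.2 (Or.inl rfl))).symm.trans
        (hlev (k', q') (mem_fedge.2 (Or.inl rfl)))
      omega
  -- PARITY, II: `n' - sb ≤ ca` (else the `f`-edge of level `ca` would be alone)
  have h2 : n' - sb ≤ ca := by
    by_contra hlt
    have hq1 : sb ≤ n' - 1 - ca := by omega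
    have hq2 : n' - 1 - ca < n' := by omega
    refine false_of_crossing_alone_level hN hU hbar hP2s (isEdge_fedge ⟨hk'U, hq2⟩)
      ((hX _).2 hq1) ⟨(k', n' - 1 - ca), mem_fedge.2 (Or.inl rfl),
        hLf _ hq1 hq2 _ (mem_fedge.2 (Or.inl rfl))⟩ fun ε' hε' hc' hlev => ?_
    rcases hall hε' hc' with ⟨e', he', rfl⟩ | ⟨q', hq', rfl⟩
    · have e1 := (hLc e' he' _ (mem_cedge.2 (Or.inl rfl))).symm.trans
        (hlev (k₂, e') (mem_cedge.2 (Or.inl rfl)))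
      omega
    · have hq'1 : sb ≤ q' := (hX q').1 hc'
      have e1 := (hLf q' hq'1 hq' _ (mem_fedge.2 (Or.inl rfl))).symm.trans
        (hlev (k', q') (mem_fedge.2 (Or.inl rfl)))
      have e2 : q' = n' - 1 - ca := by omega
      rw [e2]
  have hcasb : ca = n' - sb := le_antisymm h1 h2
  -- PAIRING: for `e < ca` the `c`-edge at `(k₂, e)` and the `f`-edge at `(k', n' - 1 - e)` lie
  -- on one component, so the head slots `(k₂, e)`, `(k̄', e)` carry the same letter
  let _i : Inhabited (surfaceGen g) := ⟨(⟨0, by omega⟩, false)⟩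
  have hletter : ∀ (e : ℕ) (h₁ : e < (fac κ.U k₂).length) (h₂ : e < (fac κ.U (κ.bar k')).length),
      e < ca → (fac κ.U k₂)[e] = (fac κ.U (κ.bar k'))[e] := by
    intro e h₁ h₂ he
    have hq1 : sb ≤ n' - 1 - e := by omega
    have hq2 : n' - 1 - e < n' := by omega
    have hh := hh₂ e he
    have hpair := sameComp_of_crossing_pair_level hN hU hbar hP2s
      (ε₂ := fedge κ.U κ.bar (k', n' - 1 - e))
      (isEdge_cedge hh.1 fun hk => hk.not_isHeadSlot hh) (hXc e he)
      ⟨(k₂, e), mem_cedge.2 (Or.inl rfl), hLc e he _ (mem_cedge.2 (Or.inl rfl))⟩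
      fun ε' hε' hc' hlev => by
        rcases hall hε' hc' with ⟨e', he', rfl⟩ | ⟨q', hq', rfl⟩
        · left
          have e1 := (hLc e' he' _ (mem_cedge.2 (Or.inl rfl))).symm.trans
            (hlev (k₂, e') (mem_cedge.2 (Or.inl rfl)))
          rw [e1]
        · right
          have hq'1 : sb ≤ q' := (hX q').1 hc'
          have e1 := (hLf q' hq'1 hq' _ (mem_fedge.2 (Or.inl rfl))).symm.trans
            (hlev (k', q') (mem_fedge.2 (Or.inl rfl)))
          have e2 : q' = n' - 1 - e := by omega
          rw [e2]
    have hfp : fpartner κ.U κ.bar (k', n' - 1 - e) = (κ.bar k', e) :=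
      Prod.ext rfl (by show (fac κ.U k').length - 1 - (n' - 1 - e) = e; omega)
    have hsc : SameComp κ.U κ.bar (k₂, e) (κ.bar k', e) := by
      have := hpair (k₂, e) (mem_cedge.2 (Or.inl rfl)) _ (mem_fedge.2 (Or.inr rfl))
      rwa [hfp] at this
    have hh' : IsHeadSlot κ.U (κ.bar k', e) := by
      have := hhd _ hq1 hq2
      rwa [show n' - 1 - (n' - 1 - e) = e by omega] at this
    have key := hsc.slotLetter_eq_of_slotType_eq hN hU hbar
      (by rw [hh.slotType_eq hN hU, hh'.slotType_eq hN hU])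
    rw [IsSlot.slotLetter_eq hh'.1, IsSlot.slotLetter_eq hh.1] at key
    exact key.symm
  -- the spur word: `head k₂ = (V̄')[0, ca) = invRev (V'[sb, n'))`
  have hhead : CycFactors.head κ.U k₂ = FreeGroup.invRev ((fac κ.U k').drop sb) := by
    have e1 : (fac κ.U k₂).take ca = (fac κ.U (κ.bar k')).take ca :=
      jp_take_eq_take hcale (by rw [hnbar]; omega) hletter
    show (fac κ.U k₂).take ca = _
    rw [e1, hVbar, take_invRev, show (fac κ.U k').length - ca = sb by omega]
  -- the vertex identity `E_{k₂} = E_{k'+1}`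
  have hocc : κ.occStart k₂ = κ.occStart (k' + 1) := by
    have hv := κ.jp_occStart_eq hg1 hI hM hmin d hk₂ hKa hPb
    rw [← hsb, hhead, ← FreeGroup.inv_mk, map_inv, inv_inv, mul_assoc, ← map_mul, FreeGroup.mul_mk,
      List.take_append_drop, κ.occStart_mul_proj_fac hk'] at hv
    exact hv
  -- the block `k₂, …, k'`
  by_cases hwrap : k₂ = 0 ∧ k' + 1 = κ.w.length
  · -- `k'` is the cyclic predecessor of `k₂`: `ca = c₂ = n' - sb`, the post-cut kernel of `k'`
    -- would be empty
    obtain ⟨rfl, hk'm⟩ := hwrap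
    have e : cpred κ.U 0 = k' := by unfold cpred; rw [length_U]; omega
    have hcc : ca = c₂ := by rw [hca, hc₂, e]
    omega
  · refine false_of_occStart_eq hI κ (j₁ := k₂) (j₂ := k' + 1) (by omega) (by omega) (by omega)
      (κ.blockClosed_of_bar fun j hj hj1 hj2 => ?_) hocc
    rcases Nat.lt_or_ge j k' with hjk | hjk
    · by_cases hbj : κ.bar j = k'
      · rw [hbj]; omega
      · have := κ.jp_bar_mem hg1 hI hM hmin d hk₂ hKa hPb hj hj1 hjk hbj
        omega
    · have hjk' : j = k' := by omega
      rw [hjk']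
      obtain ⟨h3, h4⟩ := hin
      constructor
      · rw [← κ.Kstart_le_Kstart_iff hg1 hI hM hmin, hKa]
        exact h3
      · by_contra hle
        have := κ.Kend_le_Kend (show k' ≤ κ.bar k' by omega)
        have := hPb.2
        omega

omit hK in
/-- **No double point at a junction followed by a portal whose partner is outside.**  With
`a = Kstart k₂` (spur `c_a`), `b` between the slots `sb - 1 | sb` of the value `V'` of `k'` and
`k̄'` outside: the crossing edges are the cancelling edges of the `a`-spur (levels `e < c_a`)
and the formal edges at the pre-cut slots `(k', q)`, `q < sb`, whose partners are tail slots
(levels `q`); parity gives `c_a = sb` and pairs `(k₂, e)` with `(k', e)`, both of type `Y`, so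
`head k₂ = V'[0, sb)`, `E_{k₂} = absv a · (head k₂)⁻¹ = E_{k'}`, and the block of the inside
occurrences `k₂, …, k' - 1` (symbol-closed by Claim (A), proper, and non-empty since `k₂ = k'`
would force `c_a = jc (k' - 1) < sb`) has trivial value — a decomposition.
[cite: ZieschangVogtColdewey1980, proof of Thm. 5.3.2 and Lemma 5.3.4] -/
theorem false_of_doublePoint_JP_outside {k' : ℕ} (hJa : κ.IsJunction d.a) (hPb : κ.PortalAt d.b k')
    (hout : κ.Outside d.a d.b (κ.bar k')) : False := by
  have hg1 : 1 ≤ g := by omega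
  have hN := κ.cycNielsen_U hg1 hI hM hmin
  have hU := κ.U_ne_nil hg1
  have hbar := κ.isPairing_bar
  have hab := d.lt
  have hbℓ := d.lt_length
  obtain ⟨k₂, hk₂, hKa⟩ := hJa
  have hsep : ∀ j, ¬ (κ.PortalAt d.a j ∧ κ.PortalAt d.b j) := fun j hj =>
    κ.not_portalAt_of_isJunction ⟨k₂, hk₂, hKa⟩ j hj.1
  have hP2 := DoublePoint.kpos_mem_iff_of_chainEnd κ hg1 hI hM hmin d
  have hk' : k' < κ.w.length := κ.lt_length_of_portalAt hPb hbℓ.le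
  have hk'U : k' < κ.U.length := by rw [length_U]; exact hk'
  have hk₂U : k₂ < κ.U.length := by rw [length_U]; exact hk₂
  have hk₂k' : k₂ ≤ k' := (κ.Kstart_le_Kstart_iff hg1 hI hM hmin).1
    (by rw [hKa]; exact κ.le_Kstart_of_portalAt_right hab hsep hPb)
  obtain ⟨hc₁sb, hsbn⟩ := κ.slotAt_bounds_of_portalAt hg1 hI hM hmin hPb
  have hcale : jc κ.U (cpred κ.U k₂) ≤ (fac κ.U k₂).length := jc_cpred_le_length κ.U k₂
  -- numerical data
  set n' := (fac κ.U k').length with hn'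
  have hnbar : (fac κ.U (κ.bar k')).length = n' := hbar.length_fac_bar hk'U
  set ca := jc κ.U (cpred κ.U k₂) with hca
  set sb := κ.slotAt k' d.b with hsb
  -- the side function and (P2)
  let s : ℕ × ℕ → Bool := fun σ => decide (κ.SideIn d.a d.b σ)
  have hs : ∀ σ, s σ = decide (κ.SideIn d.a d.b σ) := fun σ => rfl
  have hP2s : ∀ τ, IsKernelSlot κ.U τ → s τ = s (chainEnd κ.U κ.bar τ) := fun τ hτ =>
    κ.decide_sideIn_eq_decide_sideIn_chainEnd hg1 hI hM hmin hab hsep hP2 hτ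
  -- the crossing `c`-edges: at the head slots `(k₂, e)`, `e < ca`, of level `e`
  have hh₂ : ∀ e, e < ca → IsHeadSlot κ.U (k₂, e) := fun e he =>
    ⟨⟨hk₂U, lt_of_lt_of_le he hcale⟩, he⟩
  have hLc : ∀ e, e < ca → ∀ ρ ∈ (cedge κ.U (k₂, e)).2, level κ.U ρ = e := fun e he =>
    jp_level_cedge hN hU hbar (hh₂ e he)
  have hXc : ∀ e, e < ca → IsCrossing s (cedge κ.U (k₂, e)) := fun e he =>
    κ.jp_isCrossing_cedge hg1 hI hM hmin d hk₂ hKa hs he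
  have hall : ∀ {ε : CycFactors.Edge}, IsEdge κ.U κ.bar ε → IsCrossing s ε →
      (∃ e, e < ca ∧ ε = cedge κ.U (k₂, e)) ∨ (∃ q, q < n' ∧ ε = fedge κ.U κ.bar (k', q)) :=
    fun hε hc => κ.jp_crossing_edges hg1 hI hM hmin d hk₂ hKa hPb hs hε hc
  -- the crossing `f`-edges: at the pre-cut slots `(k', q)`, `q < sb`, facing tail slots
  have hX : ∀ q, IsCrossing s (fedge κ.U κ.bar (k', q)) ↔ q < sb := fun q => by
    rw [isCrossing_fedge, hs, hs, ← κ.fcross_iff_decide_ne]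
    exact κ.fcross_iff_of_portalAt_right_of_outside hg1 hI hM hmin hab hsep hPb hout q
  have htl : ∀ q, q < sb → IsTailSlot κ.U (κ.bar k', n' - 1 - q) := fun q hq =>
    κ.isTailSlot_of_portalAt_right_of_outside hg1 hI hM hmin hab hsep hP2 hk' hPb hout hq
  have hLf : ∀ q, q < sb → ∀ ρ ∈ (fedge κ.U κ.bar (k', q)).2, level κ.U ρ = q := by
    intro q hq ρ hρ
    have hqn : q < n' := by omega
    rw [jp_level_fedge_tail hN hU hbar (σ := (k', q)) ⟨hk'U, hqn⟩ (htl q hq) ρ hρ]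
    show (fac κ.U (κ.bar k')).length - 1 - ((fac κ.U k').length - 1 - q) = q
    rw [hnbar]
    omega
  -- PARITY, I: `ca ≤ sb` (else the `c`-edge of level `sb` would be alone)
  have h1 : ca ≤ sb := by
    by_contra hlt
    have he : sb < ca := by omega
    have hh := hh₂ _ he
    refine false_of_crossing_alone_level hN hU hbar hP2s
      (isEdge_cedge hh.1 fun hk => hk.not_isHeadSlot hh) (hXc _ he)
      ⟨(k₂, sb), mem_cedge.2 (Or.inl rfl), hLc _ he _ (mem_cedge.2 (Or.inl rfl))⟩
      fun ε' hε' hc' hlev => ?_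
    rcases hall hε' hc' with ⟨e', he', rfl⟩ | ⟨q', hq', rfl⟩
    · have e1 := (hLc e' he' _ (mem_cedge.2 (Or.inl rfl))).symm.trans
        (hlev (k₂, e') (mem_cedge.2 (Or.inl rfl)))
      rw [e1]
    · have hq'1 : q' < sb := (hX q').1 hc'
      have e1 := (hLf q' hq'1 _ (mem_fedge.2 (Or.inl rfl))).symm.trans
        (hlev (k', q') (mem_fedge.2 (Or.inl rfl)))
      omega
  -- PARITY, II: `sb ≤ ca` (else the `f`-edge of level `ca` would be alone)
  have h2 : sb ≤ ca := by
    by_contra hlt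
    have hq : ca < sb := by omega
    have hσ : IsSlot κ.U (k', ca) := ⟨hk'U, by show ca < (fac κ.U k').length; omega⟩
    refine false_of_crossing_alone_level hN hU hbar hP2s (isEdge_fedge hσ) ((hX _).2 hq)
      ⟨(k', ca), mem_fedge.2 (Or.inl rfl), hLf _ hq _ (mem_fedge.2 (Or.inl rfl))⟩
      fun ε' hε' hc' hlev => ?_
    rcases hall hε' hc' with ⟨e', he', rfl⟩ | ⟨q', hq', rfl⟩
    · have e1 := (hLc e' he' _ (mem_cedge.2 (Or.inl rfl))).symm.trans
        (hlev (k₂, e') (mem_cedge.2 (Or.inl rfl)))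
      omega
    · have hq'1 : q' < sb := (hX q').1 hc'
      have e1 := (hLf q' hq'1 _ (mem_fedge.2 (Or.inl rfl))).symm.trans
        (hlev (k', q') (mem_fedge.2 (Or.inl rfl)))
      rw [e1]
  have hcasb : ca = sb := le_antisymm h1 h2
  -- PAIRING: for `e < ca` the `c`-edge at `(k₂, e)` and the `f`-edge at `(k', e)` lie on one
  -- component; `(k₂, e)` (a head slot) and `(k', e)` (a head slot, or a kernel slot facing a
  -- tail slot) both have type `Y`, so they carry the same letter
  let _i : Inhabited (surfaceGen g) := ⟨(⟨0, by omega⟩, false)⟩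
  have hletter : ∀ (e : ℕ) (h₁ : e < (fac κ.U k₂).length) (h₂ : e < (fac κ.U k').length),
      e < ca → (fac κ.U k₂)[e] = (fac κ.U k')[e] := by
    intro e h₁ h₂ he
    have hesb : e < sb := by omega
    have hh := hh₂ e he
    have hσ : IsSlot κ.U (k', e) := ⟨hk'U, h₂⟩
    have hpair := sameComp_of_crossing_pair_level hN hU hbar hP2s
      (ε₂ := fedge κ.U κ.bar (k', e))
      (isEdge_cedge hh.1 fun hk => hk.not_isHeadSlot hh) (hXc e he)
      ⟨(k₂, e), mem_cedge.2 (Or.inl rfl), hLc e he _ (mem_cedge.2 (Or.inl rfl))⟩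
      fun ε' hε' hc' hlev => by
        rcases hall hε' hc' with ⟨e', he', rfl⟩ | ⟨q', hq', rfl⟩
        · left
          have e1 := (hLc e' he' _ (mem_cedge.2 (Or.inl rfl))).symm.trans
            (hlev (k₂, e') (mem_cedge.2 (Or.inl rfl)))
          rw [e1]
        · right
          have hq'1 : q' < sb := (hX q').1 hc'
          have e1 := (hLf q' hq'1 _ (mem_fedge.2 (Or.inl rfl))).symm.trans
            (hlev (k', q') (mem_fedge.2 (Or.inl rfl)))
          rw [e1]
    have hsc : SameComp κ.U κ.bar (k₂, e) (k', e) :=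
      hpair (k₂, e) (mem_cedge.2 (Or.inl rfl)) (k', e) (mem_fedge.2 (Or.inl rfl))
    have hty : slotType κ.U κ.bar (k', e) = false := by
      rcases hσ.trichotomy with hk | hh' | ht
      · exact hk.slotType_eq_false hN hU (htl e hesb)
      · exact hh'.slotType_eq hN hU
      · exfalso
        have := ht.2
        dsimp only at this
        omega
    have key := hsc.slotLetter_eq_of_slotType_eq hN hU hbar (by rw [hty, hh.slotType_eq hN hU])
    rw [IsSlot.slotLetter_eq hσ, IsSlot.slotLetter_eq hh.1] at key
    exact key.symm
  -- the spur word `head k₂ = V'[0, sb)` and the vertex identity `E_{k₂} = E_{k'}`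
  have hhead : CycFactors.head κ.U k₂ = (fac κ.U k').take sb := by
    show (fac κ.U k₂).take ca = _
    rw [jp_take_eq_take hcale (by omega) hletter, hcasb]
  have hocc : κ.occStart k₂ = κ.occStart k' := by
    have hv := κ.jp_occStart_eq hg1 hI hM hmin d hk₂ hKa hPb
    rw [← hsb, hhead, mul_inv_cancel_right] at hv
    exact hv
  -- the block of the inside occurrences `k₂, …, k' - 1`
  have hlt : k₂ < k' := by
    rcases hk₂k'.lt_or_eq with h | h
    · exact h
    · -- `k₂ = k'`: then `ca = jc (k' - 1) < sb = ca`
      exfalso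
      subst h
      omega
  refine false_of_occStart_eq hI κ (j₁ := k₂) (j₂ := k') hlt hk'.le (by omega)
    (κ.blockClosed_of_bar fun j hj hj1 hj2 => ?_) hocc
  have hbj : κ.bar j ≠ k' := by
    intro hbj
    have hjin : κ.Inside d.a d.b j :=
      ⟨by rw [← hKa]; exact κ.Kstart_mono hj1, (κ.Kend_le_Kstart_of_lt hj2).trans hPb.1.le⟩
    have hjU : j < κ.U.length := by rw [length_U]; exact hj
    have e : κ.bar (κ.bar j) = j := hbar.bar_bar j hjU
    rw [hbj] at e
    exact κ.not_outside_of_inside hg1 hI hM hmin hjin (e ▸ hout)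
  exact κ.jp_bar_mem hg1 hI hM hmin d hk₂ hKa hPb hj hj1 hj2 hbj

end JP

end Config

end SurfaceGroup

end Literature.Topology.FourManifolds

end
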